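import Summits.PneNP.PneNP.Theses.SzkEntropy
import Summits.PneNP.PneNP.Theorems.SzkEntropyPeaThreeNotInP
import Literature.Computability.Complexity.PRGDerandomizationPromise

/-!
# PneNP / SzkEntropy — the target `PeaThreeNotInP` (stmt-PneNP-10776) versus its kill switch

Route `PneNP/SzkEntropy` files its thesis X = `PeaThreeNotInP` (`PEA_3 ∉ PromiseP`: entropy
approximation for cubic maps over `F₂` is not in promise-`P`) together with a NEGATIVE-SIDE item,
the kill switch `PeaThreeMemBPP` (`PEA_3 ∈ PromiseBPP'`, textbook promise-`BPP`), and crux #3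
`PeaWorstToAvg` whose antecedent is `PEA_3 ∉ PromiseBPP'`.  X itself is an OPEN hardness statement
(equivalent to `SZKP_L ⊄ prP` by Dvir–Gutfreund–Rothblum–Vadhan, Thm 1.1 / 4.7, and stronger than
`P ≠ NP` through the route's deciding theorem `closes`); this file does not settle it.  It records,
as SUPPORT lemmas of the item, exactly how X sits against the kill switch:

* `szkEntropy_peaThreeNotInP_or_peaThreeMemBPP` — **the pair (target, kill switch) is exhaustive**:
  `PeaThreeNotInP ∨ PeaThreeMemBPP` holds outright, because `PromiseP ⊆ PromiseBPP'`
  (`PromiseP_subset_PromiseBPP'`, Gill 1977 Prop. 5.1 in promise form).  So one of the two filed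
  directions of the route is TRUE; what is open is which.
* `szkEntropy_peaThreeNotInP_of_not_peaThreeMemBPP` — the antecedent `PEA_3 ∉ PromiseBPP'` of crux
  `PeaWorstToAvg` (= `¬ PeaThreeMemBPP`) already gives X.
* `szkEntropy_not_peaThreeNotInP_of_peaThreeMemBPP` /
  `szkEntropy_peaThreeNotInP_iff_not_peaThreeMemBPP` — under promise derandomisation
  `PromiseBPP' ⊆ PromiseP` the kill switch is LITERALLY `¬ X`;
* `szkEntropy_not_peaThreeNotInP_of_avgHard_E` / `szkEntropy_peaThreeNotInP_iff_of_avgHard_E` —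
  the same with the derandomisation hypothesis discharged from a `2^{εn}`-average-case-hard
  language in `E` by the tree's PROVED Nisan–Wigderson theorem
  `PromiseBPP'_subset_PromiseP_of_avgHard_E` (`PRGDerandomizationPromise.lean`).

References: Z. Dvir, D. Gutfreund, G. N. Rothblum, S. Vadhan, *On approximating the entropy of
polynomial mappings*, ICS 2011 (ECCC TR10-160), Thm 1.1, §4.4; O. Goldreich, *On promise problems*
(2006), Def. 1.2 and §1.2; N. Nisan, A. Wigderson, *Hardness vs randomness*, JCSS 49 (1994), Thm 3;
J. Gill, SIAM J. Comput. 6 (1977), Prop. 5.1.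
-/

namespace Summit.PneNP.PneNP.Theorems

open Filter Literature.Computability.Complexity Literature.Computability.MetaComplexity
open Summit.PneNP.PneNP.Theses.SzkEntropy

/-- **The kill switch is the library's `PEA 3 ∈ PromiseBPP'`.** The inline `let ev/H/PEA := …`
spelling of `PeaThreeMemBPP` (route SzkEntropy, item stmt-PneNP-10781) unfolds definitionally to
membership of `Literature.Computability.Complexity.PEA 3` in the textbook promise class
`PromiseBPP'`. [DvirGutfreundRothblumVadhan2010, §3 p. 6; Goldreich2006, Def. 1.2] -/
theorem szkEntropy_peaThreeMemBPP_iff : PeaThreeMemBPP ↔ PEA 3 ∈ PromiseBPP' :=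
  Iff.rfl

/-- **Target and kill switch are jointly exhaustive**: `PeaThreeNotInP ∨ PeaThreeMemBPP`.
Either `PEA_3 ∈ PromiseP ⊆ PromiseBPP'` (Gill: a deterministic decider is a zero-error randomised
one, `PromiseP_subset_PromiseBPP'`), which is the kill switch, or `PEA_3 ∉ PromiseP`, which is X.
[Gill1977, Prop. 5.1; Goldreich2006, §1.2] -/
theorem szkEntropy_peaThreeNotInP_or_peaThreeMemBPP : PeaThreeNotInP ∨ PeaThreeMemBPP := by
  by_cases h : PEA 3 ∈ PromiseP
  · exact Or.inr (szkEntropy_peaThreeMemBPP_iff.2 (PromiseP_subset_PromiseBPP' h))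
  · exact Or.inl (szkEntropy_peaThreeNotInP_iff.2 h)

/-- **Worst-case randomised hardness gives X**: if `PEA_3 ∉ PromiseBPP'` (the antecedent of crux
`PeaWorstToAvg`, i.e. `¬ PeaThreeMemBPP`) then `PeaThreeNotInP`. [Gill1977, Prop. 5.1;
DvirGutfreundRothblumVadhan2010, pp. 2–3] -/
theorem szkEntropy_peaThreeNotInP_of_not_peaThreeMemBPP (h : ¬ PeaThreeMemBPP) : PeaThreeNotInP :=
  (szkEntropy_peaThreeNotInP_or_peaThreeMemBPP).resolve_right h

/-- **Under promise derandomisation the kill switch refutes X**: if `PromiseBPP' ⊆ PromiseP` and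
`PEA_3 ∈ PromiseBPP'` then `PEA_3 ∈ PromiseP`, i.e. `¬ PeaThreeNotInP`.
[Goldreich2006, §1.2 (Promise-BPP = Promise-P); DvirGutfreundRothblumVadhan2010, §4.4] -/
theorem szkEntropy_not_peaThreeNotInP_of_peaThreeMemBPP (hD : PromiseBPP' ⊆ PromiseP)
    (hK : PeaThreeMemBPP) : ¬ PeaThreeNotInP :=
  fun hX => szkEntropy_peaThreeNotInP_iff.1 hX (hD (szkEntropy_peaThreeMemBPP_iff.1 hK))

/-- **Under promise derandomisation X is exactly the negation of the kill switch**: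
`PromiseBPP' ⊆ PromiseP` gives `PeaThreeNotInP ↔ ¬ PeaThreeMemBPP`.
[Goldreich2006, §1.2; DvirGutfreundRothblumVadhan2010, Thm 1.1] -/
theorem szkEntropy_peaThreeNotInP_iff_not_peaThreeMemBPP (hD : PromiseBPP' ⊆ PromiseP) :
    PeaThreeNotInP ↔ ¬ PeaThreeMemBPP :=
  ⟨fun hX hK => szkEntropy_not_peaThreeNotInP_of_peaThreeMemBPP hD hK hX,
    szkEntropy_peaThreeNotInP_of_not_peaThreeMemBPP⟩

/-- **Nisan–Wigderson instance**: if some language of `E = DTIME(2^{O(n)})` is `2^{εn}`-hard on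
average against `B₂`-circuits for all large `n` (`AvgHardAtLeast`, Arora–Barak Def. 19.1), then
`PromiseBPP' = PromiseP` (the tree's proved `PromiseBPP'_subset_PromiseP_of_avgHard_E`), so the
kill switch `PeaThreeMemBPP` refutes X. [NisanWigderson1994, Thm 3 (1); AroraBarakCC2009,
Thm 20.6; DvirGutfreundRothblumVadhan2010, §4.4] -/
theorem szkEntropy_not_peaThreeNotInP_of_avgHard_E {L : Language Bool} (hL : L ∈ E) {ε : ℝ}
    (hε : 0 < ε) (hhard : ∀ᶠ n in atTop, AvgHardAtLeast (L.sliceFn n) ((2 : ℝ) ^ (ε * n)))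
    (hK : PeaThreeMemBPP) : ¬ PeaThreeNotInP :=
  szkEntropy_not_peaThreeNotInP_of_peaThreeMemBPP
    (PromiseBPP'_subset_PromiseP_of_avgHard_E hL hε hhard) hK

/-- **Nisan–Wigderson instance, equivalence form**: under a `2^{εn}`-average-case-hard language in
`E`, thesis X holds iff the kill switch fails, `PeaThreeNotInP ↔ ¬ PeaThreeMemBPP` — the route's
two filed directions are then literally complementary. [NisanWigderson1994, Thm 3 (1);
Goldreich2006, §1.2; DvirGutfreundRothblumVadhan2010, Thm 1.1] -/
theorem szkEntropy_peaThreeNotInP_iff_of_avgHard_E {L : Language Bool} (hL : L ∈ E) {ε : ℝ}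
    (hε : 0 < ε) (hhard : ∀ᶠ n in atTop, AvgHardAtLeast (L.sliceFn n) ((2 : ℝ) ^ (ε * n))) :
    PeaThreeNotInP ↔ ¬ PeaThreeMemBPP :=
  szkEntropy_peaThreeNotInP_iff_not_peaThreeMemBPP
    (PromiseBPP'_subset_PromiseP_of_avgHard_E hL hε hhard)

end Summit.PneNP.PneNP.Theorems
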